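import Summits.Ventures.Crystal3D.Theorems.StickyWulffConstantCoaxialWallLawTerracePropagation
import HarnessLib

/-!
# The line automaton of the co-axial cell: designated moves are well defined and injective

HONEST FRAMING. Part of the venture `Summits/Ventures/Crystal3D` (cell `crystal3d-full`), helper for the
crux `CoaxialWallLaw` (stmt-Ventures-19481) of `route-Ventures-StickyWulffConstant`, REGISTERED line
`WallLedgerF` (planner cf-p1 gen 16), open stub `stub_coaxialTwoSlabAdhesion` (general fillings).  Brick 2 of
the FLUX-GAP architecture (memo F-FLUXGAP-ARCH on the item): the local theory of the AUTOMATON whose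
«ends = starts» count carries the flux gap.  Rung credit only; F-C1 not moved.

DATA.  A finite `1`-separated `X`; two grain frames `F false`, `F true` (the two slot-set classes of a
co-axial pair: a grain and its basal twin); a unit axis `m` in menu position for both
(`⟪F c w, m⟫ ∈ {0, ±√(2/3)}`); the MIRROR relation `hmir`: every `F c w − 2⟪F c w, m⟫ m` is a slot vector of
the other class (the two slot sets are mirror images across `mᗮ`); a DESIGNATED up-slot vector `dsg c b`
for every class `c` and ball `b` (an `F c`-image of a far slot of `(F c, m)`), invariant under the translations
of `F c·Λ₀` (`hdsg_inv`).  Predicates, given by `iff` hypotheses so that the file is definition-free: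
`Full c b` (all twelve `b + F c w` occupied), `TD c b` (COHERENT TWIN DOZEN of class `c`: own side
`⟪F c w, m⟫ ≤ 0` occupied, mirror sites of the negative slots occupied, far slots empty), `Inv c b` (three
linearly independent exact `F c`-slot neighbours — the invariant of 19480-p1's …DozenStep).

THE MOVE `f (b, c)`: slot step `(b + dsg c b, c)` if `Full c b`, else capper step `(b + dsg c̄ b, c̄)`
(meaningful when `TD c b`: the cappers of a coherent twin dozen of class `c` are exactly the up-slots of
class `c̄` at `b`).

* `full_twin_exclusive` — `Full c b` and `TD c̄ b` never hold at the same ball (two occupied sites at distance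
  `1/√3`): the two move types never compete for a target.
* `cap_target_mem` — at a coherent twin dozen the designated capper `b + dsg c̄ b` is occupied.
* `inv_full_step`, `inv_cap_step` — the successor carries the invariant `Inv` in its class
  (`exists_exact_neighbours_fcc_step` / `exists_exact_neighbours_twin_step` + the mirror relation).
* `dsg_cancel` — `b + dsg c b = b′ + dsg c b′ → b = b′` (translation invariance of `dsg`).
* `move_injOn` — **`f` is injective on `{Full ∨ TD}`**.

WHAT THIS IS NOT: no counting yet (next files: starts/ends, the band of entries, the ledger); not the stub;
F-C1 not moved.
-/

noncomputable section

namespace Summit.Ventures.Crystal3D.Theorems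

open Summit.Ventures.Crystal3D Finset
open Literature.MathematicalPhysics.StatisticalMechanics (fccStacking)
open scoped InnerProductSpace

section Automaton

variable {X : Finset (EuclideanSpace ℝ (Fin 3))}
  {F : Bool → (EuclideanSpace ℝ (Fin 3) ≃ₗᵢ[ℝ] EuclideanSpace ℝ (Fin 3))} {m : EuclideanSpace ℝ (Fin 3)}
  {dsg : Bool → EuclideanSpace ℝ (Fin 3) → EuclideanSpace ℝ (Fin 3)}
  {Full TD Inv : Bool → EuclideanSpace ℝ (Fin 3) → Prop}

/-- The menu value of a positive slot is `√(2/3)`. -/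
theorem menu_eq_of_pos (A : EuclideanSpace ℝ (Fin 3) ≃ₗᵢ[ℝ] EuclideanSpace ℝ (Fin 3))
    {n w : EuclideanSpace ℝ (Fin 3)}
    (hmenu : ⟪A w, n⟫_ℝ = 0 ∨ ⟪A w, n⟫_ℝ = Real.sqrt (2 / 3) ∨ ⟪A w, n⟫_ℝ = -Real.sqrt (2 / 3))
    (hpos : 0 < ⟪A w, n⟫_ℝ) : ⟪A w, n⟫_ℝ = Real.sqrt (2 / 3) := by
  have hr : 0 < Real.sqrt (2 / 3) := Real.sqrt_pos.2 (by norm_num)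
  rcases hmenu with h | h | h
  · rw [h] at hpos; exact absurd hpos (lt_irrefl 0)
  · exact h
  · rw [h] at hpos; linarith

/-- The menu value of a negative slot is `−√(2/3)`. -/
theorem menu_eq_of_neg (A : EuclideanSpace ℝ (Fin 3) ≃ₗᵢ[ℝ] EuclideanSpace ℝ (Fin 3))
    {n w : EuclideanSpace ℝ (Fin 3)}
    (hmenu : ⟪A w, n⟫_ℝ = 0 ∨ ⟪A w, n⟫_ℝ = Real.sqrt (2 / 3) ∨ ⟪A w, n⟫_ℝ = -Real.sqrt (2 / 3))
    (hneg : ⟪A w, n⟫_ℝ < 0) : ⟪A w, n⟫_ℝ = -Real.sqrt (2 / 3) := by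
  have hr : 0 < Real.sqrt (2 / 3) := Real.sqrt_pos.2 (by norm_num)
  rcases hmenu with h | h | h
  · rw [h] at hneg; exact absurd hneg (lt_irrefl 0)
  · rw [h] at hneg; linarith
  · exact h

/-- **Translation cancellation for designated vectors.**  If `dsg c` is invariant under the translations
of `F c·Λ₀` and takes slot-vector values, then `b + dsg c b = b′ + dsg c b′` forces `b = b′`. -/
theorem dsg_cancel
    (hdsg_up : ∀ c b, ∃ u ∈ fccSlots, ⟪F c u, m⟫_ℝ = Real.sqrt (2 / 3) ∧ dsg c b = F c u)
    (hdsg_inv : ∀ c b, ∀ w ∈ fccStacking 1 (Real.sqrt (2 / 3)), dsg c (b + F c w) = dsg c b)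
    {c : Bool} {b b' : EuclideanSpace ℝ (Fin 3)} (h : b + dsg c b = b' + dsg c b') : b = b' := by
  obtain ⟨u, hu, -, hub⟩ := hdsg_up c b
  obtain ⟨u', hu', -, hub'⟩ := hdsg_up c b'
  have e1 : dsg c (b + dsg c b) = dsg c b := by
    conv_lhs => rw [hub]
    exact hdsg_inv c b u (mem_fcc_of_mem_fccSlots hu)
  have e2 : dsg c (b' + dsg c b') = dsg c b' := by
    conv_lhs => rw [hub']
    exact hdsg_inv c b' u' (mem_fcc_of_mem_fccSlots hu')
  have e3 : dsg c b = dsg c b' := by rw [← e1, h, e2]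
  rw [e3] at h
  exact add_right_cancel h

/-- **The two move types never compete.**  A ball with the full shell of class `c` is not a coherent twin
dozen of the mirror class `!c`: the mirror image `b + F c u₁ − 2√(2/3) m` of a far slot (an own-side slot of
class `!c`, hence occupied) lies at distance `1/√3` from the occupied down slot `b − F c u₂`. -/
theorem full_twin_exclusive (hX : ∀ p ∈ X, ∀ q ∈ X, p ≠ q → 1 ≤ dist p q) (hm : ‖m‖ = 1)
    (hmenu : ∀ c, ∀ w ∈ fccSlots,
      ⟪F c w, m⟫_ℝ = 0 ∨ ⟪F c w, m⟫_ℝ = Real.sqrt (2 / 3) ∨ ⟪F c w, m⟫_ℝ = -Real.sqrt (2 / 3))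
    (hmir : ∀ c, ∀ w ∈ fccSlots, ∃ w' ∈ fccSlots, F (!c) w' = F c w - (2 * ⟪F c w, m⟫_ℝ) • m)
    (hFull : ∀ c b, Full c b ↔ ∀ w ∈ fccSlots, b + F c w ∈ X)
    (hTD : ∀ c b, TD c b ↔
      ((∀ w ∈ fccSlots, ⟪F c w, m⟫_ℝ ≤ 0 → b + F c w ∈ X) ∧
       (∀ w ∈ fccSlots, ⟪F c w, m⟫_ℝ < 0 → b + (F c w - (2 * ⟪F c w, m⟫_ℝ) • m) ∈ X) ∧
       (∀ w ∈ fccSlots, 0 < ⟪F c w, m⟫_ℝ → b + F c w ∉ X)))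
    {c : Bool} {b : EuclideanSpace ℝ (Fin 3)} (hfull : Full c b) (htd : TD (!c) b) : False := by
  have h23 : Real.sqrt (2 / 3) ^ 2 = 2 / 3 := Real.sq_sqrt (by norm_num)
  rw [hFull] at hfull
  rw [hTD] at htd
  obtain ⟨hown, -, -⟩ := htd
  obtain ⟨u₁, hu₁, u₂, hu₂, u₃, hu₃, hn₁, hn₂, hn₃, i12, i13, i23, hind, -⟩ := exists_far_frame (F c) hm (hmenu c)
  have hne12 : u₁ ≠ u₂ := by
    intro h; rw [h, real_inner_self_eq_norm_sq, norm_eq_one_of_mem_fccSlots hu₂] at i12; norm_num at i12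
  -- the mirror image of `F c u₁` is an own-side slot of class `!c`
  obtain ⟨w', hw', hw'e⟩ := hmir c u₁ hu₁
  have hw'n : ⟪F (!c) w', m⟫_ℝ ≤ 0 := by
    rw [hw'e, inner_sub_left, real_inner_smul_left, real_inner_self_eq_norm_sq, hm, hn₁]
    have := Real.sqrt_nonneg (2 / 3 : ℝ)
    nlinarith
  have hp : b + F (!c) w' ∈ X := hown w' hw' hw'n
  have hq : b + F c (-u₂) ∈ X := hfull (-u₂) (neg_mem_fccSlots hu₂)
  -- distance `1/√3`
  have a11 : ⟪F c u₁, F c u₁⟫_ℝ = 1 := by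
    rw [real_inner_self_eq_norm_sq, LinearIsometryEquiv.norm_map, norm_eq_one_of_mem_fccSlots hu₁, one_pow]
  have a22 : ⟪F c u₂, F c u₂⟫_ℝ = 1 := by
    rw [real_inner_self_eq_norm_sq, LinearIsometryEquiv.norm_map, norm_eq_one_of_mem_fccSlots hu₂, one_pow]
  have a12 : ⟪F c u₁, F c u₂⟫_ℝ = 1 / 2 := by rw [LinearIsometryEquiv.inner_map_map, i12]
  have a21 : ⟪F c u₂, F c u₁⟫_ℝ = 1 / 2 := by rw [real_inner_comm]; exact a12
  have mm : ⟪m, m⟫_ℝ = 1 := by rw [real_inner_self_eq_norm_sq, hm, one_pow]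
  have m1 : ⟪m, F c u₁⟫_ℝ = Real.sqrt (2 / 3) := by rw [real_inner_comm]; exact hn₁
  have m2 : ⟪m, F c u₂⟫_ℝ = Real.sqrt (2 / 3) := by rw [real_inner_comm]; exact hn₂
  have hd2 : dist (b + F (!c) w') (b + F c (-u₂)) ^ 2 = 1 / 3 := by
    rw [dist_eq_norm, add_sub_add_left_eq_sub, hw'e, map_neg, hn₁, ← real_inner_self_eq_norm_sq]
    have e : F c u₁ - (2 * Real.sqrt (2 / 3)) • m - -F c u₂ = F c u₁ + F c u₂ - (2 * Real.sqrt (2 / 3)) • m := by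
      abel
    rw [e]
    simp only [inner_sub_left, inner_sub_right, inner_add_left, inner_add_right, real_inner_smul_left,
      real_inner_smul_right, a11, a22, a12, a21, hn₁, hn₂, mm, m1, m2]
    nlinarith [h23]
  have hne : b + F (!c) w' ≠ b + F c (-u₂) := by
    intro h
    rw [h, dist_self] at hd2
    norm_num at hd2
  have h1 := hX _ hp _ hq hne
  nlinarith [h1, hd2, dist_nonneg (x := b + F (!c) w') (y := b + F c (-u₂))]

/-- **The designated capper is occupied** at a coherent twin dozen of class `c`: `b + dsg c̄ b ∈ X`
(it is the mirror site of a negative slot of class `c`). -/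
theorem cap_target_mem (hm : ‖m‖ = 1)
    (hmir : ∀ c, ∀ w ∈ fccSlots, ∃ w' ∈ fccSlots, F (!c) w' = F c w - (2 * ⟪F c w, m⟫_ℝ) • m)
    (hTD : ∀ c b, TD c b ↔
      ((∀ w ∈ fccSlots, ⟪F c w, m⟫_ℝ ≤ 0 → b + F c w ∈ X) ∧
       (∀ w ∈ fccSlots, ⟪F c w, m⟫_ℝ < 0 → b + (F c w - (2 * ⟪F c w, m⟫_ℝ) • m) ∈ X) ∧
       (∀ w ∈ fccSlots, 0 < ⟪F c w, m⟫_ℝ → b + F c w ∉ X)))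
    (hdsg_up : ∀ c b, ∃ u ∈ fccSlots, ⟪F c u, m⟫_ℝ = Real.sqrt (2 / 3) ∧ dsg c b = F c u)
    {c : Bool} {b : EuclideanSpace ℝ (Fin 3)} (htd : TD c b) : b + dsg (!c) b ∈ X := by
  have hr : 0 < Real.sqrt (2 / 3) := Real.sqrt_pos.2 (by norm_num)
  rw [hTD] at htd
  obtain ⟨-, hmirror, -⟩ := htd
  obtain ⟨u', hu', hu'n, hde⟩ := hdsg_up (!c) b
  obtain ⟨w, hw, hwe⟩ := hmir (!c) u' hu'
  rw [Bool.not_not] at hwe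
  have mm : ⟪m, m⟫_ℝ = 1 := by rw [real_inner_self_eq_norm_sq, hm, one_pow]
  have hwn : ⟪F c w, m⟫_ℝ = -Real.sqrt (2 / 3) := by
    rw [hwe, inner_sub_left, real_inner_smul_left, mm, hu'n]; ring
  have key := hmirror w hw (by rw [hwn]; linarith)
  rw [hde]
  convert key using 2
  rw [hwn, hwe, hu'n]
  module

/-- **Invariant after a slot step.**  From a full shell of class `c` the successor `b + dsg c b` has three
linearly independent exact `F c`-slot neighbours. -/
theorem inv_full_step
    (hFull : ∀ c b, Full c b ↔ ∀ w ∈ fccSlots, b + F c w ∈ X)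
    (hInv : ∀ c b, Inv c b ↔ ∃ a ∈ fccSlots, ∃ a' ∈ fccSlots, ∃ a'' ∈ fccSlots,
      LinearIndependent ℝ ![a, a', a''] ∧ b + F c a ∈ X ∧ b + F c a' ∈ X ∧ b + F c a'' ∈ X)
    (hdsg_up : ∀ c b, ∃ u ∈ fccSlots, ⟪F c u, m⟫_ℝ = Real.sqrt (2 / 3) ∧ dsg c b = F c u)
    {c : Bool} {b : EuclideanSpace ℝ (Fin 3)} (hb : b ∈ X) (hfull : Full c b) : Inv c (b + dsg c b) := by
  rw [hFull] at hfull
  obtain ⟨u, hu, -, hde⟩ := hdsg_up c b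
  obtain ⟨a, ha, a', ha', a'', ha'', hind, h1, h2, h3⟩ := exists_exact_neighbours_fcc_step (F c) hb hfull hu
  rw [hInv, hde]
  exact ⟨a, ha, a', ha', a'', ha'', hind, h1, h2, h3⟩

/-- **Invariant after a capper step.**  From a coherent twin dozen of class `c` the designated capper
`b + dsg c̄ b` has three linearly independent exact `F c̄`-slot neighbours (…DozenStep's twin step in the
twin frame `x ↦ F c x − 2⟪F c x, m⟫ m`, whose slot vectors are the slot vectors of class `c̄`). -/
theorem inv_cap_step (hm : ‖m‖ = 1)
    (hmenu : ∀ c, ∀ w ∈ fccSlots,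
      ⟪F c w, m⟫_ℝ = 0 ∨ ⟪F c w, m⟫_ℝ = Real.sqrt (2 / 3) ∨ ⟪F c w, m⟫_ℝ = -Real.sqrt (2 / 3))
    (hmir : ∀ c, ∀ w ∈ fccSlots, ∃ w' ∈ fccSlots, F (!c) w' = F c w - (2 * ⟪F c w, m⟫_ℝ) • m)
    (hTD : ∀ c b, TD c b ↔
      ((∀ w ∈ fccSlots, ⟪F c w, m⟫_ℝ ≤ 0 → b + F c w ∈ X) ∧
       (∀ w ∈ fccSlots, ⟪F c w, m⟫_ℝ < 0 → b + (F c w - (2 * ⟪F c w, m⟫_ℝ) • m) ∈ X) ∧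
       (∀ w ∈ fccSlots, 0 < ⟪F c w, m⟫_ℝ → b + F c w ∉ X)))
    (hInv : ∀ c b, Inv c b ↔ ∃ a ∈ fccSlots, ∃ a' ∈ fccSlots, ∃ a'' ∈ fccSlots,
      LinearIndependent ℝ ![a, a', a''] ∧ b + F c a ∈ X ∧ b + F c a' ∈ X ∧ b + F c a'' ∈ X)
    (hdsg_up : ∀ c b, ∃ u ∈ fccSlots, ⟪F c u, m⟫_ℝ = Real.sqrt (2 / 3) ∧ dsg c b = F c u)
    {c : Bool} {b : EuclideanSpace ℝ (Fin 3)} (hb : b ∈ X) (htd : TD c b) : Inv (!c) (b + dsg (!c) b) := by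
  have hr : 0 < Real.sqrt (2 / 3) := Real.sqrt_pos.2 (by norm_num)
  have mm : ⟪m, m⟫_ℝ = 1 := by rw [real_inner_self_eq_norm_sq, hm, one_pow]
  rw [hTD] at htd
  obtain ⟨hown, hmirror, -⟩ := htd
  -- the designated capper as a twin step `b + A' w`
  obtain ⟨u', hu', hu'n, hde⟩ := hdsg_up (!c) b
  obtain ⟨w, hw, hwe⟩ := hmir (!c) u' hu'
  rw [Bool.not_not] at hwe
  have hwn : ⟪F c w, m⟫_ℝ = -Real.sqrt (2 / 3) := by
    rw [hwe, inner_sub_left, real_inner_smul_left, mm, hu'n]; ring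
  obtain ⟨A', hA'⟩ := exists_twinFrame (F c) hm
  have hstep : b + A' w = b + dsg (!c) b := by
    rw [hA', hde, hwn, hwe, hu'n]; module
  obtain ⟨a, ha, a', ha', a'', ha'', hind, h1, h2, h3⟩ :=
    exists_exact_neighbours_twin_step (X := X) (F c) A' hb hm (hmenu c) hown hmirror hA' hw (by rw [hwn]; linarith)
  rw [hstep] at h1 h2 h3
  -- translate the `A'`-slots into `F c̄`-slots
  obtain ⟨e, he, hee⟩ := hmir c a ha
  obtain ⟨e', he', hee'⟩ := hmir c a' ha'
  obtain ⟨e'', he'', hee''⟩ := hmir c a'' ha''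
  have k1 : A' a = F (!c) e := by rw [hA', hee]
  have k2 : A' a' = F (!c) e' := by rw [hA', hee']
  have k3 : A' a'' = F (!c) e'' := by rw [hA', hee'']
  rw [hInv]
  refine ⟨e, he, e', he', e'', he'', ?_, by rw [← k1]; exact h1, by rw [← k2]; exact h2, by rw [← k3]; exact h3⟩
  have hind' : LinearIndependent ℝ ![A' a, A' a', A' a''] := linearIndependent_map_triple A' hind
  rw [k1, k2, k3] at hind'
  have := linearIndependent_map_triple (F (!c)).symm hind'
  simpa only [LinearIsometryEquiv.symm_apply_apply] using this

open scoped Classical in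
/-- **The move is injective on its domain.**  With
`f (b, c) = if Full c b then (b + dsg c b, c) else (b + dsg c̄ b, c̄)`, two states in `{Full ∨ TD}` with the
same image are equal. -/
theorem move_injOn (hX : ∀ p ∈ X, ∀ q ∈ X, p ≠ q → 1 ≤ dist p q) (hm : ‖m‖ = 1)
    (hmenu : ∀ c, ∀ w ∈ fccSlots,
      ⟪F c w, m⟫_ℝ = 0 ∨ ⟪F c w, m⟫_ℝ = Real.sqrt (2 / 3) ∨ ⟪F c w, m⟫_ℝ = -Real.sqrt (2 / 3))
    (hmir : ∀ c, ∀ w ∈ fccSlots, ∃ w' ∈ fccSlots, F (!c) w' = F c w - (2 * ⟪F c w, m⟫_ℝ) • m)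
    (hFull : ∀ c b, Full c b ↔ ∀ w ∈ fccSlots, b + F c w ∈ X)
    (hTD : ∀ c b, TD c b ↔
      ((∀ w ∈ fccSlots, ⟪F c w, m⟫_ℝ ≤ 0 → b + F c w ∈ X) ∧
       (∀ w ∈ fccSlots, ⟪F c w, m⟫_ℝ < 0 → b + (F c w - (2 * ⟪F c w, m⟫_ℝ) • m) ∈ X) ∧
       (∀ w ∈ fccSlots, 0 < ⟪F c w, m⟫_ℝ → b + F c w ∉ X)))
    (hdsg_up : ∀ c b, ∃ u ∈ fccSlots, ⟪F c u, m⟫_ℝ = Real.sqrt (2 / 3) ∧ dsg c b = F c u)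
    (hdsg_inv : ∀ c b, ∀ w ∈ fccStacking 1 (Real.sqrt (2 / 3)), dsg c (b + F c w) = dsg c b) :
    Set.InjOn (fun v : EuclideanSpace ℝ (Fin 3) × Bool =>
        if Full v.2 v.1 then (v.1 + dsg v.2 v.1, v.2) else (v.1 + dsg (!v.2) v.1, !v.2))
      {v | Full v.2 v.1 ∨ TD v.2 v.1} := by
  rintro ⟨b, c⟩ hv ⟨b', c'⟩ hv' heq
  simp only [Set.mem_setOf_eq] at hv hv'
  simp only at heq
  by_cases hf : Full c b <;> by_cases hf' : Full c' b' <;> simp only [hf, hf', if_true, if_false] at heq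
  · obtain ⟨h1, rfl⟩ := Prod.mk.inj heq
    rw [dsg_cancel hdsg_up hdsg_inv h1]
  · obtain ⟨h1, h2⟩ := Prod.mk.inj heq
    subst h2
    have hb : b = b' := dsg_cancel hdsg_up hdsg_inv h1
    subst hb
    exact (full_twin_exclusive hX hm hmenu hmir hFull hTD hf (by simpa using hv'.resolve_left hf')).elim
  · obtain ⟨h1, h2⟩ := Prod.mk.inj heq
    subst h2
    have hb : b = b' := dsg_cancel hdsg_up hdsg_inv h1
    subst hb
    exact (full_twin_exclusive hX hm hmenu hmir hFull hTD hf' (by simpa using hv.resolve_left hf)).elim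
  · obtain ⟨h1, h2⟩ := Prod.mk.inj heq
    have hc : c = c' := Bool.not_inj h2
    subst hc
    rw [dsg_cancel hdsg_up hdsg_inv h1]

end Automaton

end Summit.Ventures.Crystal3D.Theorems

end
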